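import Summits.ResolutionOfSingularities.ResolutionOfSingularities.Theorems.FrobeniusLadderFInjectiveMacaulayficationAffineBlowupPolynomial
import Summits.ResolutionOfSingularities.ResolutionOfSingularities.Theorems.FrobeniusLadderFInjectiveMacaulayficationIsBlowupStalkTransfer
import Summits.ResolutionOfSingularities.ResolutionOfSingularities.Theorems.FrobeniusLadderFInjectiveMacaulayficationIsBlowupStalkOffSupport
import Literature.AlgebraicGeometry.Resolution.BlowupAlgebraPrimesPoints
import Literature.AlgebraicGeometry.Resolution.AffineBlowupUniversal
import Literature.AlgebraicGeometry.Resolution.AffineBlowupUnique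
import Literature.AlgebraicGeometry.Resolution.IdealSheafLemmas
import Literature.AlgebraicGeometry.Resolution.BlowupsScaling
import HarnessLib

/-!
# The FC′ CYLINDER INSTANCE: the body of `FCForallExists` (currency (A′)) holds for `X₁ = Y × 𝔸¹` at the generic point of
# `{y₀} × 𝔸¹`, for `Y = Spec R` with one isolated point-fixable bad closed point `y₀`
# (crux `FInjectiveMacaulayfication` stmt-ResolutionOfSingularities-15315, chain w45a, hole #3γ; res-L1-w45a-plan-1 R13.9 (4);
# seat res-L1-w45a-stub-3)

[OURS · L1 W4.5a] Support file (`--supports stmt-ResolutionOfSingularities-15315 --as helper`) for the crux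
`FrobeniusLadder.FInjectiveMacaulayfication`. NOT a statement of any manuscript; no named fact; AI-written (AI review is weaker than
expert review). It is the FIRST INHABITED INSTANCE (calibration rung) of the v29 door stub `stub_fcForallExists :
GenericFibreReduction.FCForallExists` (`…FCForallExists.lean`, res-L1-w45a-strat-1's `GenericFibreSig` §G5b filed by stub-7): the
conclusion of that statement — a spread `J`, a re-chosen LocFix datum `c'` at `η` with `J_η = (c')`, and the fibre condition «every
blowing up along `J` is FULL at the non-closed points over `supp J ∖ {η}` and Cohen–Macaulay at the closed points over `supp J`» — is
PRODUCED for the cylinder over a point model.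

## Setting and statement (`fcForallExists_body_cylinder`)

`R` is a Noetherian domain of characteristic `p`, `Y = Spec R`, `y₀ ∈ Y` a CLOSED point such that
* (`hoff`) every other local ring `R_𝔭`, `𝔭 ≠ 𝔪_{y₀}`, satisfies the per-stalk clause of the crux (every system of parameters weakly
  regular, parameter ideals Frobenius closed) — `y₀` is the only (possibly) bad point;
* (`h0`) `y₀` is POINT-FIXABLE (hole 5e's output, the `h0` shape of `SpecimenDoor` / `RoadBFrame`): some `c₀ : Fin m → 𝒪_{Y,y₀}` with
  `(c₀) ≠ 0`, `√(c₀) = 𝔪_{y₀}`, and every prime of every chart `𝒪_{Y,y₀}[(c₀)/c₀ⱼ]` over `𝔪_{y₀}` FULL (domain ∧ clause).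
Let `X₁ = Y × 𝔸¹ = Spec R[t]` and `η ∈ X₁` the point `𝔪_{y₀}·R[t]` (the generic point of the line `{y₀} × 𝔸¹`). THEN the body of
`FCForallExists` holds at `(X₁, η)`: there are an ideal sheaf `J ≠ ⊥` on `X₁` with `η ∈ supp J`, and `c' : Fin m → 𝒪_{X₁,η}` with
`(c') ≠ 0`, `(c') ≤ 𝔪_η`, every chart of `Bl_{(c')} Spec 𝒪_{X₁,η}` FULL over `𝔪_η`, `J_η = (c')`, and for EVERY blowing up
`π : X₂ → X₁` along `J` (universal property `IsBlowup`) EVERY stalk of `X₂` is FULL — in particular the (nc)/(cl) clauses of FC′.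

## Construction and proof

`I := (c₀) ∩ R` (an `𝔪_{y₀}`-primary ideal with `I·𝒪_{Y,y₀} = (c₀)`), `J := (I·R[t])~` (`affineBlowup.idealSheaf`), `c' :=` the image
of `c₀` under the localisation map `ψ : 𝒪_{Y,y₀} = R_{𝔪₀} → R[t]_{𝔪₀R[t]} = 𝒪_{X₁,η}`.
* §1 `affineBlowup_fiClause_of_pointFix`: EVERY stalk of the point model `Bl_I(Y)` is FULL — over `y₀` by the Stacks-0804 dictionary
  `IsBlowup.exists_blowupAlgebra_stalk_ringEquiv_of_eq` (as in `PointFixableCentre.pointFixable_h4`), off `y₀` because the blowing up is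
  an isomorphism off `supp Ĩ = {y₀}` (`IsBlowupStalkOffSupport`) and `hoff`.
* §2 `fiClause_of_isBlowup_cylinder`: hence every stalk of `Bl_{I R[t]}(X₁) = Bl_I(Y) × 𝔸¹` is FULL (S4
  `AffineBlowupPolynomial.affineBlowup_fiClause_polynomial`, the cylinder ascent), and so is every stalk of ANY blowing up of `X₁`
  along `J` (`affineBlowup.isBlowup` + uniqueness `IsBlowupStalkTransfer`).
* §3 the witness data at `η`: `J_η = I·𝒪_η = ψ((c₀)) = (c')` (`IsLocalization.map_comp`), `(c') ≤ 𝔪_η` (`ψ` maps `𝔪₀𝒪_{y₀}` into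
  `𝔪₀R[t]·𝒪_η = 𝔪_η`), `(c') ≠ 0` (`R[t] → 𝒪_η` is injective), and the charts of `Bl_{(c')} Spec 𝒪_η` over `𝔪_η` are local rings of
  points of `Bl_{I R[t]}(X₁)` over `η` (reverse dictionary `IsBlowup.exists_point_of_blowupAlgebra_prime`, Stacks 0804/0805), FULL by §2.

Why it is only a calibration rung: the cylinder is the one class where the scar `closure{η} = {y₀} × 𝔸¹` carries a PRODUCT structure,
so the point-fix spreads with no special points; FC′ in general asks for the same at the special points of an arbitrary curve/surface
`closure{η}` (kill test K4.5g). No definitions, no named facts. [folklore assembly; cite: StacksProject, Tag 0804, Tag 0805, Tag 02OS]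
-/

-- single-problem summit: the doubled namespace component is forced
set_option linter.dupNamespace false

noncomputable section

open Polynomial AlgebraicGeometry CategoryTheory Literature.AlgebraicGeometry.Resolution TopologicalSpace IsLocalRing

namespace Summit.ResolutionOfSingularities.ResolutionOfSingularities.Theorems.FInjectiveMacaulayfication.FCForallExistsCylinder

open Summit.ResolutionOfSingularities.ResolutionOfSingularities.Theorems.FInjectiveMacaulayfication

/-! ## §0 The ideal sheaf `Ĩ` on `Spec R`: stalks and support -/

section IdealSheaf

variable {R : Type} [CommRing R]

/-- **The stalk of `Ĩ` at a prime `𝔭` is `I·R_𝔭`** (structure-sheaf algebra on the stalk). [cite: Hartshorne1977, II Prop. 5.1 (b)] -/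
theorem stalkIdeal_idealSheaf (I : Ideal R) (y : Spec (.of R)) :
    letI : Algebra R ((Spec (.of R)).presheaf.stalk y) := inferInstanceAs (Algebra R ((Spec.structureSheaf R).presheaf.stalk y))
    stalkIdeal (affineBlowup.idealSheaf I) y = I.map (algebraMap R ((Spec (.of R)).presheaf.stalk y)) := by
  letI : Algebra R ((Spec (.of R)).presheaf.stalk y) := inferInstanceAs (Algebra R ((Spec.structureSheaf R).presheaf.stalk y))
  rw [stalkIdeal_eq_map_germ (affineBlowup.idealSheaf I) ⟨⊤, isAffineOpen_top _⟩ trivial, affineBlowup.idealSheaf,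
    ideal_ofIdealTop_top, Ideal.map_map]
  rfl

/-- `𝔭 ∈ supp Ĩ ↔ I ≤ 𝔭`. [folklore] -/
theorem mem_support_idealSheaf_iff (I : Ideal R) (y : Spec (.of R)) :
    y ∈ ((affineBlowup.idealSheaf I).support : Set (Spec (.of R))) ↔ I ≤ y.asIdeal := by
  rw [affineBlowup.support_idealSheaf]
  exact Iff.trans (PrimeSpectrum.mem_zeroLocus (R := R) y I) SetLike.coe_subset_coe

end IdealSheaf

/-! ## §1 The point model `Bl_I(Spec R)` is FULL at every stalk -/

/-- **§1 — POINT-FIX + `hoff` ⟹ THE POINT MODEL IS FULL EVERYWHERE.** `R` a Noetherian domain of characteristic `p`; `y₀ ∈ Spec R`;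
every local ring `R_𝔭`, `𝔭 ≠ y₀`, satisfies the clause (`hoff`); `c₀ : Fin m → 𝒪_{y₀}` with `√(c₀) = 𝔪_{y₀}` and all charts
`𝒪_{y₀}[(c₀)/c₀ⱼ]` FULL over `𝔪_{y₀}` (`hgood`); `I ⊆ R` an ideal with `Ĩ_{y₀} = (c₀)` whose support is `⊆ {y₀}`. Then every stalk of
`affineBlowup I` is a domain satisfying the clause: over `y₀` by the dictionary `𝒪_x ≅ (𝒪_{y₀}[(c₀)/c₀ⱼ])_𝔔`, `𝔔 ∩ 𝒪_{y₀} = 𝔪_{y₀}`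
(Stacks 0804); elsewhere the blowing up is a local isomorphism and `𝒪_x ≅ 𝒪_{Spec R, y} ≅ R_y`.
[cite: StacksProject, Tag 0804, Tag 02OS] -/
theorem affineBlowup_fiClause_of_pointFix (p : ℕ) [Fact p.Prime] (R : Type) [CommRing R] [IsDomain R] [IsNoetherianRing R]
    [CharP R p] (y₀ : Spec (.of R))
    (hoff : ∀ y : Spec (.of R), y ≠ y₀ → ∀ d : ℕ, ringKrullDim (Localization.AtPrime y.asIdeal) = d →
      ∀ s : Fin d → Localization.AtPrime y.asIdeal, (Ideal.span (Set.range s)).radical.IsMaximal →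
        RingTheory.Sequence.IsWeaklyRegular (Localization.AtPrime y.asIdeal) (List.ofFn s) ∧
        ∀ z : Localization.AtPrime y.asIdeal, (∃ e : ℕ, z ^ p ^ e ∈ Ideal.span ((fun w : Localization.AtPrime y.asIdeal => w ^ p ^ e) ''
          (Ideal.span (Set.range s) : Set (Localization.AtPrime y.asIdeal)))) → z ∈ Ideal.span (Set.range s))
    {m : ℕ} (c₀ : Fin m → (Spec (.of R)).presheaf.stalk y₀)
    (hrad : (Ideal.span (Set.range c₀)).radical = maximalIdeal ((Spec (.of R)).presheaf.stalk y₀))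
    (hgood : ∀ (j : Fin m) (𝔔 : PrimeSpectrum (blowupAlgebra (Ideal.span (Set.range c₀)) (c₀ j))),
      𝔔.asIdeal.comap (algebraMap ((Spec (.of R)).presheaf.stalk y₀) (blowupAlgebra (Ideal.span (Set.range c₀)) (c₀ j))) =
        maximalIdeal ((Spec (.of R)).presheaf.stalk y₀) →
      IsDomain (Localization.AtPrime 𝔔.asIdeal) ∧ ∀ d : ℕ, ringKrullDim (Localization.AtPrime 𝔔.asIdeal) = d →
        ∀ s : Fin d → Localization.AtPrime 𝔔.asIdeal, (Ideal.span (Set.range s)).radical.IsMaximal →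
          RingTheory.Sequence.IsWeaklyRegular (Localization.AtPrime 𝔔.asIdeal) (List.ofFn s) ∧
          ∀ y : Localization.AtPrime 𝔔.asIdeal, (∃ e : ℕ, y ^ p ^ e ∈ Ideal.span ((fun z : Localization.AtPrime 𝔔.asIdeal => z ^ p ^ e) ''
            (Ideal.span (Set.range s) : Set (Localization.AtPrime 𝔔.asIdeal)))) → y ∈ Ideal.span (Set.range s))
    (I : Ideal R) (hIc : stalkIdeal (affineBlowup.idealSheaf I) y₀ = Ideal.span (Set.range c₀))
    (hIy : ∀ y : Spec (.of R), y ∈ ((affineBlowup.idealSheaf I).support : Set (Spec (.of R))) → y = y₀) :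
    ∀ x : ↥(affineBlowup I), IsDomain ((affineBlowup I).presheaf.stalk x) ∧
      ∀ d : ℕ, ringKrullDim ((affineBlowup I).presheaf.stalk x) = d →
        ∀ s : Fin d → (affineBlowup I).presheaf.stalk x, (Ideal.span (Set.range s)).radical.IsMaximal →
          RingTheory.Sequence.IsWeaklyRegular ((affineBlowup I).presheaf.stalk x) (List.ofFn s) ∧
          ∀ z : (affineBlowup I).presheaf.stalk x, (∃ e : ℕ, z ^ p ^ e ∈
              Ideal.span ((fun w : (affineBlowup I).presheaf.stalk x => w ^ p ^ e) ''
                (Ideal.span (Set.range s) : Set ((affineBlowup I).presheaf.stalk x)))) →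
            z ∈ Ideal.span (Set.range s) := by
  intro x
  have hπ := affineBlowup.isBlowup I
  by_cases hx : (affineBlowup.π I).base x ∈ ((affineBlowup.idealSheaf I).support : Set (Spec (.of R)))
  · -- over `y₀`: the Stacks-0804 dictionary and `hgood`
    have hxy : (affineBlowup.π I).base x = y₀ := hIy _ hx
    subst hxy
    obtain ⟨j, 𝔔, -, e, -, -, -, h𝔔⟩ :=
      hπ.exists_blowupAlgebra_stalk_ringEquiv_of_eq x c₀ (Ideal.span (Set.range c₀)) rfl hIc.symm
    obtain ⟨hdom, hq⟩ := hgood j 𝔔 h𝔔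
    haveI := hdom
    exact ⟨MulEquiv.isDomain (Localization.AtPrime 𝔔.asIdeal) e.toMulEquiv,
      DegreeZeroDescent.inlineClause_of_ringEquiv p (L := Localization.AtPrime 𝔔.asIdeal)
        (L' := (affineBlowup I).presheaf.stalk x) e.symm hq⟩
  · -- off `y₀`: the blowing up is a local isomorphism, `𝒪_x ≅ 𝒪_{Spec R, y} ≅ R_y`
    set y := (affineBlowup.π I).base x with hy
    have hne : y ≠ y₀ := by
      rintro h
      apply hx
      rw [h]
      exact (mem_support_iff_stalkIdeal_le _ _).mpr (hIc.trans_le (Ideal.le_radical.trans hrad.le))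
    obtain ⟨e₁⟩ := IsBlowupStalkOffSupport.stub_isBlowupStalkOffSupport _ _ _ _ hπ x hx
    let e : (affineBlowup I).presheaf.stalk x ≃+* Localization.AtPrime y.asIdeal :=
      e₁.trans (Spec.stalkIso (.of R) y).commRingCatIsoToRingEquiv
    haveI : IsDomain (Localization.AtPrime y.asIdeal) :=
      IsLocalization.isDomain_localization y.asIdeal.primeCompl_le_nonZeroDivisors
    exact ⟨MulEquiv.isDomain (Localization.AtPrime y.asIdeal) e.toMulEquiv,
      DegreeZeroDescent.inlineClause_of_ringEquiv p (L := Localization.AtPrime y.asIdeal)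
        (L' := (affineBlowup I).presheaf.stalk x) e.symm (hoff y hne)⟩

/-! ## §2 The cylinder: every blowing up of `Spec R[t]` along `(I·R[t])~` is FULL at every stalk -/

/-- **§2 — THE CYLINDER OVER A GOOD POINT MODEL IS FULL, FOR EVERY BLOWING UP ALONG `(I·R[t])~`.** If every stalk of `Bl_I(Spec R)` is
a domain satisfying the clause (`R` a Noetherian domain of characteristic `p`), then so is every stalk of every blowing up
`π : X₂ → Spec R[t]` along the ideal sheaf of `I·R[t]` (universal property): `Bl_{I R[t]} = Bl_I × 𝔸¹` is FULL everywhere by the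
cylinder ascent S4 (`AffineBlowupPolynomial.affineBlowup_fiClause_polynomial`), it IS a blowing up along `(I·R[t])~`
(`affineBlowup.isBlowup`, GW Prop. 13.92), and two blowing ups along the same ideal sheaf have the same stalks (`IsBlowupStalkTransfer`).
[cite: GortzWedhorn2020, Prop. 13.92 and (13.19)] -/
theorem fiClause_of_isBlowup_cylinder (p : ℕ) [Fact p.Prime] (R : Type) [CommRing R] [IsDomain R] [IsNoetherianRing R]
    [CharP R p] (I : Ideal R)
    (hBl : ∀ y : ↥(affineBlowup I), IsDomain ((affineBlowup I).presheaf.stalk y) ∧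
      ∀ d : ℕ, ringKrullDim ((affineBlowup I).presheaf.stalk y) = d →
        ∀ s : Fin d → (affineBlowup I).presheaf.stalk y, (Ideal.span (Set.range s)).radical.IsMaximal →
          RingTheory.Sequence.IsWeaklyRegular ((affineBlowup I).presheaf.stalk y) (List.ofFn s) ∧
          ∀ z : (affineBlowup I).presheaf.stalk y, (∃ e : ℕ, z ^ p ^ e ∈
              Ideal.span ((fun w : (affineBlowup I).presheaf.stalk y => w ^ p ^ e) ''
                (Ideal.span (Set.range s) : Set ((affineBlowup I).presheaf.stalk y)))) →
            z ∈ Ideal.span (Set.range s)) :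
    ∀ (X₂ : Scheme.{0}) (π : X₂ ⟶ Spec (.of R[X])), IsBlowup π (affineBlowup.idealSheaf (I.map (C : R →+* R[X]))) →
      ∀ x : X₂, IsDomain (X₂.presheaf.stalk x) ∧ ∀ d : ℕ, ringKrullDim (X₂.presheaf.stalk x) = d → ∀ s : Fin d → X₂.presheaf.stalk x,
        (Ideal.span (Set.range s)).radical.IsMaximal → RingTheory.Sequence.IsWeaklyRegular (X₂.presheaf.stalk x) (List.ofFn s) ∧
        ∀ t : X₂.presheaf.stalk x, (∃ e : ℕ, t ^ p ^ e ∈ Ideal.span ((fun z : X₂.presheaf.stalk x => z ^ p ^ e) ''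
          (Ideal.span (Set.range s) : Set (X₂.presheaf.stalk x)))) → t ∈ Ideal.span (Set.range s) := by
  intro X₂ π hπ x
  obtain ⟨x'', -, ⟨e⟩⟩ := IsBlowupStalkTransfer.stub_isBlowupStalkTransfer _ _ _ _ π
    (affineBlowup.π (I.map (C : R →+* R[X]))) hπ (affineBlowup.isBlowup _) x
  obtain ⟨hdom, hcl⟩ := AffineBlowupPolynomial.affineBlowup_fiClause_polynomial p R I hBl x''
  haveI := hdom
  exact ⟨MulEquiv.isDomain _ e.toMulEquiv,
    DegreeZeroDescent.inlineClause_of_ringEquiv p (L := (affineBlowup (I.map (C : R →+* R[X]))).presheaf.stalk x'')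
      (L' := X₂.presheaf.stalk x) e.symm hcl⟩

/-! ## §3 The FC′ body for the cylinder at the generic point of `{y₀} × 𝔸¹` -/

/-- **§3 — THE CYLINDER WITNESS (strong form).** `R` a Noetherian domain of characteristic `p`, `y₀ ∈ Spec R` closed with all other
local rings satisfying the clause (`hoff`) and `y₀` point-fixable (`h0`), `η = 𝔪_{y₀}·R[t] ∈ Spec R[t]`. Then for `J := (I·R[t])~`,
`I = (c₀) ∩ R`, and `c' :=` the image of the point-fix `c₀` in `𝒪_{X₁,η} = R[t]_{𝔪_{y₀}R[t]}`: `J ≠ ⊥`, `η ∈ supp J`, `(c') ≠ 0`,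
`(c') ≤ 𝔪_η`, every chart of `Bl_{(c')} Spec 𝒪_η` over `𝔪_η` is FULL, `J_η = (c')`, and EVERY blowing up of `Spec R[t]` along `J` is
FULL AT EVERY STALK. [cite: StacksProject, Tag 0804, Tag 0805] -/
theorem cylinder_witness (p : ℕ) [Fact p.Prime] (R : Type) [CommRing R] [IsDomain R] [IsNoetherianRing R] [CharP R p]
    (y₀ : Spec (.of R)) (hy₀ : IsClosed ({y₀} : Set (Spec (.of R))))
    (hoff : ∀ y : Spec (.of R), y ≠ y₀ → ∀ d : ℕ, ringKrullDim (Localization.AtPrime y.asIdeal) = d →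
      ∀ s : Fin d → Localization.AtPrime y.asIdeal, (Ideal.span (Set.range s)).radical.IsMaximal →
        RingTheory.Sequence.IsWeaklyRegular (Localization.AtPrime y.asIdeal) (List.ofFn s) ∧
        ∀ z : Localization.AtPrime y.asIdeal, (∃ e : ℕ, z ^ p ^ e ∈ Ideal.span ((fun w : Localization.AtPrime y.asIdeal => w ^ p ^ e) ''
          (Ideal.span (Set.range s) : Set (Localization.AtPrime y.asIdeal)))) → z ∈ Ideal.span (Set.range s))
    (h0 : ∃ (m : ℕ) (c₀ : Fin m → (Spec (.of R)).presheaf.stalk y₀), Ideal.span (Set.range c₀) ≠ ⊥ ∧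
      (Ideal.span (Set.range c₀)).radical = maximalIdeal ((Spec (.of R)).presheaf.stalk y₀) ∧
      ∀ (j : Fin m) (𝔔 : PrimeSpectrum (blowupAlgebra (Ideal.span (Set.range c₀)) (c₀ j))),
        𝔔.asIdeal.comap (algebraMap ((Spec (.of R)).presheaf.stalk y₀) (blowupAlgebra (Ideal.span (Set.range c₀)) (c₀ j))) =
          maximalIdeal ((Spec (.of R)).presheaf.stalk y₀) →
        IsDomain (Localization.AtPrime 𝔔.asIdeal) ∧ ∀ d : ℕ, ringKrullDim (Localization.AtPrime 𝔔.asIdeal) = d →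
          ∀ s : Fin d → Localization.AtPrime 𝔔.asIdeal, (Ideal.span (Set.range s)).radical.IsMaximal →
            RingTheory.Sequence.IsWeaklyRegular (Localization.AtPrime 𝔔.asIdeal) (List.ofFn s) ∧
            ∀ y : Localization.AtPrime 𝔔.asIdeal, (∃ e : ℕ, y ^ p ^ e ∈ Ideal.span ((fun z : Localization.AtPrime 𝔔.asIdeal => z ^ p ^ e) ''
              (Ideal.span (Set.range s) : Set (Localization.AtPrime 𝔔.asIdeal)))) → y ∈ Ideal.span (Set.range s))
    (η : Spec (.of R[X])) (hη : η.asIdeal = y₀.asIdeal.map (C : R →+* R[X])) :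
    ∃ (J : (Spec (.of R[X])).IdealSheafData) (n' : ℕ) (c' : Fin n' → (Spec (.of R[X])).presheaf.stalk η),
      J ≠ ⊥ ∧ η ∈ (J.support : Set (Spec (.of R[X]))) ∧
      Ideal.span (Set.range c') ≠ ⊥ ∧ Ideal.span (Set.range c') ≤ maximalIdeal ((Spec (.of R[X])).presheaf.stalk η) ∧
      (∀ (j : Fin n') (𝔔 : PrimeSpectrum (blowupAlgebra (Ideal.span (Set.range c')) (c' j))),
        𝔔.asIdeal.comap (algebraMap ((Spec (.of R[X])).presheaf.stalk η) (blowupAlgebra (Ideal.span (Set.range c')) (c' j))) =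
          maximalIdeal ((Spec (.of R[X])).presheaf.stalk η) →
        IsDomain (Localization.AtPrime 𝔔.asIdeal) ∧ ∀ d : ℕ, ringKrullDim (Localization.AtPrime 𝔔.asIdeal) = d →
          ∀ s : Fin d → Localization.AtPrime 𝔔.asIdeal, (Ideal.span (Set.range s)).radical.IsMaximal →
            RingTheory.Sequence.IsWeaklyRegular (Localization.AtPrime 𝔔.asIdeal) (List.ofFn s) ∧
            ∀ y : Localization.AtPrime 𝔔.asIdeal, (∃ e : ℕ, y ^ p ^ e ∈ Ideal.span ((fun z : Localization.AtPrime 𝔔.asIdeal => z ^ p ^ e) ''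
              (Ideal.span (Set.range s) : Set (Localization.AtPrime 𝔔.asIdeal)))) → y ∈ Ideal.span (Set.range s)) ∧
      stalkIdeal J η = Ideal.span (Set.range c') ∧
      ∀ (X₂ : Scheme.{0}) (π : X₂ ⟶ Spec (.of R[X])), IsBlowup π J →
        ∀ x : X₂, IsDomain (X₂.presheaf.stalk x) ∧ ∀ d : ℕ, ringKrullDim (X₂.presheaf.stalk x) = d → ∀ s : Fin d → X₂.presheaf.stalk x,
          (Ideal.span (Set.range s)).radical.IsMaximal → RingTheory.Sequence.IsWeaklyRegular (X₂.presheaf.stalk x) (List.ofFn s) ∧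
          ∀ t : X₂.presheaf.stalk x, (∃ e : ℕ, t ^ p ^ e ∈ Ideal.span ((fun z : X₂.presheaf.stalk x => z ^ p ^ e) ''
            (Ideal.span (Set.range s) : Set (X₂.presheaf.stalk x)))) → t ∈ Ideal.span (Set.range s) := by
  obtain ⟨m, c₀, hc0, hrad, hgood⟩ := h0
  -- the structure-sheaf algebras on the two stalks: `𝒪_{y₀} = R_{𝔪₀}`, `𝒪_η = R[t]_η`
  letI algY : Algebra R ((Spec (.of R)).presheaf.stalk y₀) :=
    inferInstanceAs (Algebra R ((Spec.structureSheaf R).presheaf.stalk y₀))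
  haveI : IsLocalization.AtPrime ((Spec (.of R)).presheaf.stalk y₀) y₀.asIdeal :=
    inferInstanceAs (IsLocalization.AtPrime ((Spec.structureSheaf R).presheaf.stalk y₀) y₀.asIdeal)
  letI algX : Algebra R[X] ((Spec (.of R[X])).presheaf.stalk η) :=
    inferInstanceAs (Algebra R[X] ((Spec.structureSheaf R[X]).presheaf.stalk η))
  haveI : IsLocalization.AtPrime ((Spec (.of R[X])).presheaf.stalk η) η.asIdeal :=
    inferInstanceAs (IsLocalization.AtPrime ((Spec.structureSheaf R[X]).presheaf.stalk η) η.asIdeal)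
  -- the contracted centre `I = (c₀) ∩ R`: `I·𝒪_{y₀} = (c₀)`, `I ≠ 0`, `√I = 𝔪_{y₀}`, `V(I) = {y₀}`
  set I : Ideal R := (Ideal.span (Set.range c₀)).under R with hIdef
  have hImap : I.map (algebraMap R ((Spec (.of R)).presheaf.stalk y₀)) = Ideal.span (Set.range c₀) :=
    IsLocalization.map_under y₀.asIdeal.primeCompl ((Spec (.of R)).presheaf.stalk y₀) _
  have hI0 : I ≠ ⊥ := fun h => hc0 (by rw [← hImap, h, Ideal.map_bot])
  have hm : y₀.asIdeal.IsMaximal := (PrimeSpectrum.isClosed_singleton_iff_isMaximal y₀).mp hy₀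
  have hIrad : I.radical = y₀.asIdeal := by
    rw [hIdef, Ideal.under_def, ← Ideal.comap_radical, hrad]
    exact IsLocalization.AtPrime.under_maximalIdeal ((Spec (.of R)).presheaf.stalk y₀) y₀.asIdeal
  have hIle : I ≤ y₀.asIdeal := hIrad ▸ Ideal.le_radical
  have hIy : ∀ y : Spec (.of R), y ∈ ((affineBlowup.idealSheaf I).support : Set (Spec (.of R))) → y = y₀ := by
    intro y hy
    rw [mem_support_idealSheaf_iff] at hy
    have h1 : y₀.asIdeal ≤ y.asIdeal := hIrad ▸ (y.isPrime.radical_le_iff.mpr hy)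
    exact (PrimeSpectrum.ext (hm.eq_of_le y.isPrime.ne_top h1)).symm
  have hIc : stalkIdeal (affineBlowup.idealSheaf I) y₀ = Ideal.span (Set.range c₀) := (stalkIdeal_idealSheaf I y₀).trans hImap
  -- §1 + §2: every blowing up of `Spec R[t]` along `J = (I·R[t])~` is FULL at every stalk
  have hBl := affineBlowup_fiClause_of_pointFix p R y₀ hoff c₀ hrad hgood I hIc hIy
  have hfull := fiClause_of_isBlowup_cylinder p R I hBl
  -- §3 the witness at `η`: `ψ : 𝒪_{y₀} → 𝒪_η` over `C : R → R[t]`, `c' = ψ ∘ c₀`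
  have hMT : y₀.asIdeal.primeCompl ≤ η.asIdeal.primeCompl.comap (C : R →+* R[X]) := by
    intro s hs
    change C s ∉ η.asIdeal
    rw [hη]
    intro h
    exact hs (by simpa using (Ideal.mem_map_C_iff.mp h) 0)
  let ψ : (Spec (.of R)).presheaf.stalk y₀ →+* (Spec (.of R[X])).presheaf.stalk η :=
    IsLocalization.map (M := y₀.asIdeal.primeCompl) (T := η.asIdeal.primeCompl) ((Spec (.of R[X])).presheaf.stalk η)
      (C : R →+* R[X]) hMT
  have hψ : ψ.comp (algebraMap R ((Spec (.of R)).presheaf.stalk y₀)) = (algebraMap R[X] ((Spec (.of R[X])).presheaf.stalk η)).comp C :=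
    IsLocalization.map_comp hMT
  let c' : Fin m → (Spec (.of R[X])).presheaf.stalk η := fun j => ψ (c₀ j)
  have hspan : Ideal.span (Set.range c') = (Ideal.span (Set.range c₀)).map ψ := by
    rw [Ideal.map_span, ← Set.range_comp]
    rfl
  -- `J_η = I·𝒪_η = (c')`
  have h1 : stalkIdeal (affineBlowup.idealSheaf (I.map (C : R →+* R[X]))) η =
      (I.map (C : R →+* R[X])).map (algebraMap R[X] ((Spec (.of R[X])).presheaf.stalk η)) :=
    stalkIdeal_idealSheaf _ _
  have hJη : stalkIdeal (affineBlowup.idealSheaf (I.map (C : R →+* R[X]))) η = Ideal.span (Set.range c') := by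
    rw [h1, Ideal.map_map, ← hψ, ← Ideal.map_map, hImap, hspan]
  -- `(c') ≤ 𝔪_η`
  have hle : Ideal.span (Set.range c') ≤ maximalIdeal ((Spec (.of R[X])).presheaf.stalk η) := by
    rw [hspan]
    calc (Ideal.span (Set.range c₀)).map ψ ≤ (maximalIdeal ((Spec (.of R)).presheaf.stalk y₀)).map ψ :=
          Ideal.map_mono (Ideal.le_radical.trans hrad.le)
      _ = maximalIdeal ((Spec (.of R[X])).presheaf.stalk η) := by
          rw [← IsLocalization.AtPrime.map_eq_maximalIdeal y₀.asIdeal ((Spec (.of R)).presheaf.stalk y₀), Ideal.map_map, hψ,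
            ← Ideal.map_map, ← hη, IsLocalization.AtPrime.map_eq_maximalIdeal η.asIdeal ((Spec (.of R[X])).presheaf.stalk η)]
  -- `(c') ≠ 0`
  have hne : Ideal.span (Set.range c') ≠ ⊥ := by
    rw [← hJη, h1]
    have hinj : Function.Injective (algebraMap R[X] ((Spec (.of R[X])).presheaf.stalk η)) :=
      IsLocalization.injective _ η.asIdeal.primeCompl_le_nonZeroDivisors
    intro h
    exact hI0 ((Ideal.map_eq_bot_iff_of_injective Polynomial.C_injective).mp ((Ideal.map_eq_bot_iff_of_injective hinj).mp h))
  -- `η ∈ supp J`, `J ≠ ⊥`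
  have hηJ : η ∈ ((affineBlowup.idealSheaf (I.map (C : R →+* R[X]))).support : Set (Spec (.of R[X]))) := by
    rw [mem_support_idealSheaf_iff, hη]
    exact Ideal.map_mono hIle
  have hJ0 : affineBlowup.idealSheaf (I.map (C : R →+* R[X])) ≠ ⊥ :=
    affineBlowup.idealSheaf_ne_bot fun h => hI0 ((Ideal.map_eq_bot_iff_of_injective Polynomial.C_injective).mp h)
  -- the charts of `Bl_{(c')} Spec 𝒪_η` over `𝔪_η` are stalks of `Bl_{I R[t]}` (reverse dictionary), hence FULL
  have hgood' : ∀ (j : Fin m) (𝔔 : PrimeSpectrum (blowupAlgebra (Ideal.span (Set.range c')) (c' j))),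
      𝔔.asIdeal.comap (algebraMap ((Spec (.of R[X])).presheaf.stalk η) (blowupAlgebra (Ideal.span (Set.range c')) (c' j))) =
        maximalIdeal ((Spec (.of R[X])).presheaf.stalk η) →
      IsDomain (Localization.AtPrime 𝔔.asIdeal) ∧ ∀ d : ℕ, ringKrullDim (Localization.AtPrime 𝔔.asIdeal) = d →
        ∀ s : Fin d → Localization.AtPrime 𝔔.asIdeal, (Ideal.span (Set.range s)).radical.IsMaximal →
          RingTheory.Sequence.IsWeaklyRegular (Localization.AtPrime 𝔔.asIdeal) (List.ofFn s) ∧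
          ∀ y : Localization.AtPrime 𝔔.asIdeal, (∃ e : ℕ, y ^ p ^ e ∈ Ideal.span ((fun z : Localization.AtPrime 𝔔.asIdeal => z ^ p ^ e) ''
            (Ideal.span (Set.range s) : Set (Localization.AtPrime 𝔔.asIdeal)))) → y ∈ Ideal.span (Set.range s) := by
    intro j 𝔔 h𝔔
    obtain ⟨x', -, ⟨e⟩⟩ :=
      (affineBlowup.isBlowup (I.map (C : R →+* R[X]))).exists_point_of_blowupAlgebra_prime η c' hJη.symm j 𝔔 h𝔔
    obtain ⟨hdom, hcl⟩ := hfull _ _ (affineBlowup.isBlowup _) x'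
    haveI := hdom
    exact ⟨MulEquiv.isDomain _ e.symm.toMulEquiv,
      DegreeZeroDescent.inlineClause_of_ringEquiv p (L := (affineBlowup (I.map (C : R →+* R[X]))).presheaf.stalk x')
        (L' := Localization.AtPrime 𝔔.asIdeal) e hcl⟩
  exact ⟨affineBlowup.idealSheaf (I.map (C : R →+* R[X])), m, c', hJ0, hηJ, hne, hle, hgood', hJη, hfull⟩

/-- **THE FC′ CYLINDER INSTANCE — the body of `GenericFibreReduction.FCForallExists` (currency (A′), §G5b) PRODUCED for
`X₁ = Spec R × 𝔸¹` at the generic point `η` of `{y₀} × 𝔸¹`**, from `hoff` (all local rings of `Spec R` other than `y₀` satisfy the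
clause) and `h0` (point-fixability of `y₀`, the 5e output): an ideal sheaf `J ≠ ⊥` with `η ∈ supp J`, a LocFix datum `c'` at `η`
(`(c') ≠ 0`, `(c') ≤ 𝔪_η`, charts FULL over `𝔪_η`) with `J_η = (c')`, such that every blowing up along `J` is FULL at the non-closed
points over `supp J ∖ {η}` and Cohen–Macaulay at the closed points over `supp J` — literally the seven conjuncts of the v29 door stub's
conclusion. (`cylinder_witness` gives more: every stalk of every such blowing up is FULL.) First inhabited instance of the research
stub `stub_fcForallExists`; a calibration rung, not evidence for FC′ at non-product scars. [folklore assembly; cite: StacksProject, Tag 0805] -/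
theorem fcForallExists_body_cylinder (p : ℕ) [Fact p.Prime] (R : Type) [CommRing R] [IsDomain R] [IsNoetherianRing R] [CharP R p]
    (y₀ : Spec (.of R)) (hy₀ : IsClosed ({y₀} : Set (Spec (.of R))))
    (hoff : ∀ y : Spec (.of R), y ≠ y₀ → ∀ d : ℕ, ringKrullDim (Localization.AtPrime y.asIdeal) = d →
      ∀ s : Fin d → Localization.AtPrime y.asIdeal, (Ideal.span (Set.range s)).radical.IsMaximal →
        RingTheory.Sequence.IsWeaklyRegular (Localization.AtPrime y.asIdeal) (List.ofFn s) ∧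
        ∀ z : Localization.AtPrime y.asIdeal, (∃ e : ℕ, z ^ p ^ e ∈ Ideal.span ((fun w : Localization.AtPrime y.asIdeal => w ^ p ^ e) ''
          (Ideal.span (Set.range s) : Set (Localization.AtPrime y.asIdeal)))) → z ∈ Ideal.span (Set.range s))
    (h0 : ∃ (m : ℕ) (c₀ : Fin m → (Spec (.of R)).presheaf.stalk y₀), Ideal.span (Set.range c₀) ≠ ⊥ ∧
      (Ideal.span (Set.range c₀)).radical = maximalIdeal ((Spec (.of R)).presheaf.stalk y₀) ∧
      ∀ (j : Fin m) (𝔔 : PrimeSpectrum (blowupAlgebra (Ideal.span (Set.range c₀)) (c₀ j))),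
        𝔔.asIdeal.comap (algebraMap ((Spec (.of R)).presheaf.stalk y₀) (blowupAlgebra (Ideal.span (Set.range c₀)) (c₀ j))) =
          maximalIdeal ((Spec (.of R)).presheaf.stalk y₀) →
        IsDomain (Localization.AtPrime 𝔔.asIdeal) ∧ ∀ d : ℕ, ringKrullDim (Localization.AtPrime 𝔔.asIdeal) = d →
          ∀ s : Fin d → Localization.AtPrime 𝔔.asIdeal, (Ideal.span (Set.range s)).radical.IsMaximal →
            RingTheory.Sequence.IsWeaklyRegular (Localization.AtPrime 𝔔.asIdeal) (List.ofFn s) ∧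
            ∀ y : Localization.AtPrime 𝔔.asIdeal, (∃ e : ℕ, y ^ p ^ e ∈ Ideal.span ((fun z : Localization.AtPrime 𝔔.asIdeal => z ^ p ^ e) ''
              (Ideal.span (Set.range s) : Set (Localization.AtPrime 𝔔.asIdeal)))) → y ∈ Ideal.span (Set.range s))
    (η : Spec (.of R[X])) (hη : η.asIdeal = y₀.asIdeal.map (C : R →+* R[X])) :
    ∃ (J : (Spec (.of R[X])).IdealSheafData) (n' : ℕ) (c' : Fin n' → (Spec (.of R[X])).presheaf.stalk η),
      J ≠ ⊥ ∧ η ∈ (J.support : Set (Spec (.of R[X]))) ∧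
      Ideal.span (Set.range c') ≠ ⊥ ∧ Ideal.span (Set.range c') ≤ maximalIdeal ((Spec (.of R[X])).presheaf.stalk η) ∧
      (∀ (j : Fin n') (𝔔 : PrimeSpectrum (blowupAlgebra (Ideal.span (Set.range c')) (c' j))),
        𝔔.asIdeal.comap (algebraMap ((Spec (.of R[X])).presheaf.stalk η) (blowupAlgebra (Ideal.span (Set.range c')) (c' j))) =
          maximalIdeal ((Spec (.of R[X])).presheaf.stalk η) →
        IsDomain (Localization.AtPrime 𝔔.asIdeal) ∧ ∀ d : ℕ, ringKrullDim (Localization.AtPrime 𝔔.asIdeal) = d →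
          ∀ s : Fin d → Localization.AtPrime 𝔔.asIdeal, (Ideal.span (Set.range s)).radical.IsMaximal →
            RingTheory.Sequence.IsWeaklyRegular (Localization.AtPrime 𝔔.asIdeal) (List.ofFn s) ∧
            ∀ y : Localization.AtPrime 𝔔.asIdeal, (∃ e : ℕ, y ^ p ^ e ∈ Ideal.span ((fun z : Localization.AtPrime 𝔔.asIdeal => z ^ p ^ e) ''
              (Ideal.span (Set.range s) : Set (Localization.AtPrime 𝔔.asIdeal)))) → y ∈ Ideal.span (Set.range s)) ∧
      stalkIdeal J η = Ideal.span (Set.range c') ∧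
      (∀ (X₂ : Scheme.{0}) (π : X₂ ⟶ Spec (.of R[X])), IsBlowup π J →
        (∀ x : X₂, π.base x ∈ (J.support : Set (Spec (.of R[X]))) → π.base x ≠ η → ¬ IsClosed ({x} : Set X₂) →
          IsDomain (X₂.presheaf.stalk x) ∧ ∀ d : ℕ, ringKrullDim (X₂.presheaf.stalk x) = d → ∀ s : Fin d → X₂.presheaf.stalk x,
            (Ideal.span (Set.range s)).radical.IsMaximal → RingTheory.Sequence.IsWeaklyRegular (X₂.presheaf.stalk x) (List.ofFn s) ∧
            ∀ t : X₂.presheaf.stalk x, (∃ e : ℕ, t ^ p ^ e ∈ Ideal.span ((fun z : X₂.presheaf.stalk x => z ^ p ^ e) ''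
              (Ideal.span (Set.range s) : Set (X₂.presheaf.stalk x)))) → t ∈ Ideal.span (Set.range s)) ∧
        (∀ x : X₂, π.base x ∈ (J.support : Set (Spec (.of R[X]))) → IsClosed ({x} : Set X₂) →
          ∀ d : ℕ, ringKrullDim (X₂.presheaf.stalk x) = d → ∀ s : Fin d → X₂.presheaf.stalk x,
            (Ideal.span (Set.range s)).radical.IsMaximal → RingTheory.Sequence.IsWeaklyRegular (X₂.presheaf.stalk x) (List.ofFn s))) := by
  obtain ⟨J, n', c', hJ0, hηJ, hne, hle, hgood', hJη, hfull⟩ := cylinder_witness p R y₀ hy₀ hoff h0 η hη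
  exact ⟨J, n', c', hJ0, hηJ, hne, hle, hgood', hJη, fun X₂ π hπ =>
    ⟨fun x _ _ _ => hfull X₂ π hπ x, fun x _ _ d hd s hs => ((hfull X₂ π hπ x).2 d hd s hs).1⟩⟩

end Summit.ResolutionOfSingularities.ResolutionOfSingularities.Theorems.FInjectiveMacaulayfication.FCForallExistsCylinder

end
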